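import Summits.RiemannHypothesis.RiemannHypothesis.Theorems.UniversalFactorLaguerreLift
import Literature.Analysis.Complex.LaguerrePolyaVertical

/-!
# RiemannHypothesis / UniversalFactor — the two-point certificate for `LehmerPointNoGo` (and every `F_a`)

Route `RiemannHypothesis/UniversalFactor`, item `LehmerPointNoGo` (stmt-RiemannHypothesis-2582):
`F_16` has a non-real zero, where for real `a`
`F_a(z) = ∫₀^∞ Φ(u) (1 + u²/a²)⁻¹ cos(zu) du = deBruijnHDiv (fun u ↦ 1 + u²/a²) z`
is the Laplace(a)-smoothed de Bruijn transform (`H_0 = F_a − F_a''/a²`).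

The item is a CERTIFIED COMPUTATION.  This file proves, sorry-free and unconditionally, the reduction
of the item to ONE strict inequality between two values of `F_16` at explicit points — the hypothesis
that the ball-arithmetic certificate (kit job attached to the item as evidence) verifies:

* `UniversalFactor.not_hasOnlyRealZeros_laplace_of_norm_lt` — **two-point certificate**, every real
  `a`: if `‖F_a(x + iy)‖ < ‖F_a(x)‖` for ONE real `x` and ONE `y ≥ 0`, then `F_a` has a non-real zero
  (`y ↦ |F_a(x + iy)|` is non-decreasing for real entire functions of order `< 2` with only real zeros:
  `Literature.Analysis.Complex.monotoneOn_norm_sq_vertical`, Hadamard-free, packaged as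
  `exists_zero_im_ne_zero_of_norm_vertical_lt_norm_ofReal`; `F_a` is real entire of order `< 2` by
  de Bruijn's Thm. 10, `UniversalFactor.exists_growth_deBruijnHDiv_laplace`);
* `UniversalFactor.not_hasOnlyRealZeros_laplace_of_norm_vertical_lt` — both points off the axis;
* `UniversalFactor.lehmerPointNoGo_of_norm_lt` — the case `a = 16`: the route decl `LehmerPointNoGo`
  (`deBruijnHDiv_laplace_eq` is `rfl`).

Compared with the one-point Laguerre certificate (`UniversalFactorLaguerreCriterion.lean`,
`lehmerPointNoGo_of_certificate`: signs of `H_0` and of the two one-sided Laplace averages), this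
certificate needs no derivative and no sign structure: two evaluations of `F_16`.

The numerics (kit job, python-flint/Arb): with `H_0(w) = ξ(1/2 + iw/2)/8` (`deBruijnH_zero_eq_holds`)
and `F_a(z) = ∫ℝ (a/2)e^{−a|y|} H_0(z − y) dy` (`deBruijnHDiv_laplace_eq_conv`), Laplace(16)-smoothing
fills the dip of `H_0` between Lehmer's zeros `2γ = 14010.126, 14010.201`; the non-real zero pair of
`F_16` sits at `≈ 14010.16 ± 0.08 i`, and the inequality holds at `x ≈ 14010.16`, `y ≈ 0.08`
(dyadic rationals recorded in the certificate).

References: G. Pólya, J. Schur (1914) / B. Ja. Levin, *Distribution of zeros of entire functions*,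
Ch. VIII (vertical monotonicity of the modulus in the Laguerre–Pólya class); N. G. de Bruijn, Duke
Math. J. 17 (1950), Thm. 10; G. Csordas, W. Smith, R. S. Varga, Constr. Approx. 10 (1994) (Lehmer
pairs of zeros).
-/

noncomputable section

namespace Summit.RiemannHypothesis.RiemannHypothesis.Theorems

open Complex
open Literature.NumberTheory.LFunctions Literature.Analysis.Complex
open Summit.RiemannHypothesis.RiemannHypothesis.Theses

/-- **Two-point certificate for `F_a`, both points possibly off the axis.** If
`‖F_a(x + iy₂)‖ < ‖F_a(x + iy₁)‖` for some real `x` and `0 ≤ y₁ ≤ y₂`, then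
`F_a = deBruijnHDiv (1 + u²/a²)` does not have only real zeros. [folklore] -/
theorem UniversalFactor.not_hasOnlyRealZeros_laplace_of_norm_vertical_lt {a x y₁ y₂ : ℝ}
    (hy₁ : 0 ≤ y₁) (h12 : y₁ ≤ y₂)
    (hlt : ‖deBruijnHDiv (fun u : ℝ => 1 + u ^ 2 / a ^ 2) (x + I * y₂)‖ <
      ‖deBruijnHDiv (fun u : ℝ => 1 + u ^ 2 / a ^ 2) (x + I * y₁)‖) :
    ¬ HasOnlyRealZeros (deBruijnHDiv fun u : ℝ => 1 + u ^ 2 / a ^ 2) := by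
  intro h
  obtain ⟨ρ, C, hρ0, hρ, hgr⟩ := UniversalFactor.exists_growth_deBruijnHDiv_laplace a
  obtain ⟨z, hz, hzim⟩ := exists_zero_im_ne_zero_of_norm_vertical_lt
    (differentiable_deBruijnHDiv_laplace a) hρ0 hρ hgr (fun t ↦ deBruijnHDiv_ofReal_im _ t)
    hy₁ h12 hlt
  exact hzim (h z hz)

/-- **Two-point certificate for `F_a`** (`y₁ = 0`): if `‖F_a(x + iy)‖ < ‖F_a(x)‖` for some real `x`
and `y ≥ 0`, then `F_a = deBruijnHDiv (1 + u²/a²)` does not have only real zeros. [folklore] -/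
theorem UniversalFactor.not_hasOnlyRealZeros_laplace_of_norm_lt {a x y : ℝ} (hy : 0 ≤ y)
    (hlt : ‖deBruijnHDiv (fun u : ℝ => 1 + u ^ 2 / a ^ 2) (x + I * y)‖ <
      ‖deBruijnHDiv (fun u : ℝ => 1 + u ^ 2 / a ^ 2) x‖) :
    ¬ HasOnlyRealZeros (deBruijnHDiv fun u : ℝ => 1 + u ^ 2 / a ^ 2) := by
  refine UniversalFactor.not_hasOnlyRealZeros_laplace_of_norm_vertical_lt (x := x) le_rfl hy ?_
  simpa using hlt

/-- **`LehmerPointNoGo` from the two-point certificate.** If `‖F_16(x + iy)‖ < ‖F_16(x)‖` for some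
real `x` and `y ≥ 0` (certified by ball arithmetic at dyadic `x ≈ 14010.16`, `y ≈ 0.08`, kit job on
item stmt-RiemannHypothesis-2582), then `F_16` has a non-real zero: the route decl
`UniversalFactor.LehmerPointNoGo`. [folklore] -/
theorem UniversalFactor.lehmerPointNoGo_of_norm_lt {x y : ℝ} (hy : 0 ≤ y)
    (hlt : ‖deBruijnHDiv (fun u : ℝ => 1 + u ^ 2 / (16 : ℝ) ^ 2) (x + I * y)‖ <
      ‖deBruijnHDiv (fun u : ℝ => 1 + u ^ 2 / (16 : ℝ) ^ 2) x‖) :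
    UniversalFactor.LehmerPointNoGo :=
  UniversalFactor.not_hasOnlyRealZeros_laplace_of_norm_lt hy hlt

end Summit.RiemannHypothesis.RiemannHypothesis.Theorems
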